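import Summits.CriticalPhenomena.PercolationContinuityZ3.Theorems.PercNearOneGluingNoHeavyQuantLSCoreMMGIneqA
import Summits.CriticalPhenomena.PercolationContinuityZ3.Theorems.PercNearOneGluingNoHeavyQuantLSCoreLLGIneqA
import Summits.CriticalPhenomena.PercolationContinuityZ3.Theorems.PercNearOneGluingNoHeavyQuantLSCoreLLGIneqB
import Summits.CriticalPhenomena.PercolationContinuityZ3.Theorems.PercNearOneGluingNoHeavyQuantLSCoreLLGIneqC
import Summits.CriticalPhenomena.PercolationContinuityZ3.Theorems.PercNearOneGluingNoHeavyQuantLSCoreLLGIneqD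
import Summits.CriticalPhenomena.PercolationContinuityZ3.Theorems.PercNearOneGluingNoHeavyQuantLSCoreLLGIneqE
import Mathlib.Tactic.Linarith
import Mathlib.Tactic.FieldSimp
import Mathlib.Tactic.Ring
import HarnessLib

/-!
# QUANT lane R8, T-DEC, binder (II) `ConvClosedTResidue`: LS-CORE, pattern LLG — the breakpoint inequalities of the two-low greedy after
# pre-routing both row-`m` lows into the head cell (kG)

builds on p205010 (kernel theorem, internal audit signed; external expert review pending)

Support file (`--supports stmt-CriticalPhenomena-4575`), QUANT lane seat prim-quant-census-1 (gen 22), rung R8 of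
`run/shared/lean/prim/quant/LADDER.md`.  Theorems only, standard axioms, no sorries.  Memo `…/prim-quant-census-1/LSCORE-G22.md` §9–§10.

Pattern LLG (`2(m+l′) < T`): both light cells of row `m` are lows; `m+l′` (pair "4", deficit `r+d−2w`, span `1−w`, always light) and then
`m+l` (pair "3") are pre-routed into the head cell `p+h`, rests to the giant; the two row-`p` lows then see the head cell (residual capacity
`cPres`) and the residual pool.  Where a cell would be too large for a certificate the light pre-routing efficiency is replaced by its
lower bound `1/x − 1` (a light pair never costs more than the giant rate) — a monotone weakening proved inside the lemma.

[this work].  The gluing rows served [cite: KozmaNitzan2024, Conjecture 3 (p. 15)]; product measure [cite: Grimmett1999, §1.3 p. 10].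
-/

namespace Summit.CriticalPhenomena.PercolationContinuityZ3.Theorems

namespace Quant

namespace LawDec

namespace LSCoreLLG
set_option maxHeartbeats 8000000 in
/-- `kG_LLG`, branch where pair 4 saturates (`hs4`). [this work] -/
theorem kG_LLG_s (x r t d w e2P e3 cP1 pool1 cPres poolres : ℝ) (hx0 : 0 < x) (hx1 : x < 1) (hr0 : 0 ≤ r) (hrx : r < x) (_ht : 0 < t) (hw0 : 0 < w) (hw1 : w < 1)
    (_hd0 : 0 ≤ d) (_hdx : d < x * w) (hre : 0 < r - x + t * (2 - x)) (_hre1 : 0 < 1 - t - r)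
    (_hM2 : 2 * w < r + d)
    (_h2P_N : 1 ≤ (r + d) → e2P = 0)
    (_h2P_H : x ≤ (r + d) → (r + d) < 1 → e2P = (1 / (r + d) - 1))
    (_h2P_L : (r + d) < x → e2P = (1 / ((1 - x) * (r + d) + x ^ (2:ℕ)) - 1))
    (h3_H : x * (1 + t - w) ≤ (r + d + 2 * t - 2 * w) → e3 = (((1 + t - w) - (r + d + 2 * t - 2 * w)) / (r + d + 2 * t - 2 * w)))
    (h3_L : (r + d + 2 * t - 2 * w) < x * (1 + t - w) → e3 = (((1 + t - w) - ((1 - x) * (r + d + 2 * t - 2 * w) + x ^ (2:ℕ) * (1 + t - w))) / ((1 - x) * (r + d + 2 * t - 2 * w) + x ^ (2:ℕ) * (1 + t - w))))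
    (_hc4_f : ((x ^ (2:ℕ) + (1 - x) * d / w) * (1 - x) * ((1 + x - r) * (r - x + t * (2 - x)) / (t * (2 - x ^ (2:ℕ) - (1 - x) * r) - x * (x - r)))) ≤ ((1 - (x ^ (2:ℕ) + (1 - x) * d / w)) * x) * (((1 - w) - ((1 - x) * (r + d - 2 * w) + x ^ (2:ℕ) * (1 - w))) / ((1 - x) * (r + d - 2 * w) + x ^ (2:ℕ) * (1 - w))) → cP1 = ((1 - (x ^ (2:ℕ) + (1 - x) * d / w)) * x) - ((x ^ (2:ℕ) + (1 - x) * d / w) * (1 - x) * ((1 + x - r) * (r - x + t * (2 - x)) / (t * (2 - x ^ (2:ℕ) - (1 - x) * r) - x * (x - r)))) / (((1 - w) - ((1 - x) * (r + d - 2 * w) + x ^ (2:ℕ) * (1 - w))) / ((1 - x) * (r + d - 2 * w) + x ^ (2:ℕ) * (1 - w))) ∧ pool1 = ((x ^ (2:ℕ) + (1 - x) * d / w) * (1 - x)))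
    (hc4_s : ((1 - (x ^ (2:ℕ) + (1 - x) * d / w)) * x) * (((1 - w) - ((1 - x) * (r + d - 2 * w) + x ^ (2:ℕ) * (1 - w))) / ((1 - x) * (r + d - 2 * w) + x ^ (2:ℕ) * (1 - w))) < ((x ^ (2:ℕ) + (1 - x) * d / w) * (1 - x) * ((1 + x - r) * (r - x + t * (2 - x)) / (t * (2 - x ^ (2:ℕ) - (1 - x) * r) - x * (x - r)))) → cP1 = 0 ∧ pool1 = (((x ^ (2:ℕ) + (1 - x) * d / w) * (1 - x)) - ((x ^ (2:ℕ) + (1 - x) * d / w) * (1 - x) * ((1 + x - r) * (r - x + t * (2 - x)) / (t * (2 - x ^ (2:ℕ) - (1 - x) * r) - x * (x - r)))) + ((1 - (x ^ (2:ℕ) + (1 - x) * d / w)) * x) * (((1 - w) - ((1 - x) * (r + d - 2 * w) + x ^ (2:ℕ) * (1 - w))) / ((1 - x) * (r + d - 2 * w) + x ^ (2:ℕ) * (1 - w)))))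
    (_hc3_f : ((x ^ (2:ℕ) + (1 - x) * d / w) * (1 - x) * ((x - r) * (1 - t - r) / (t * (2 - x ^ (2:ℕ) - (1 - x) * r) - x * (x - r)))) ≤ cP1 * e3 → cPres = cP1 - ((x ^ (2:ℕ) + (1 - x) * d / w) * (1 - x) * ((x - r) * (1 - t - r) / (t * (2 - x ^ (2:ℕ) - (1 - x) * r) - x * (x - r)))) / e3 ∧ poolres = pool1)
    (hc3_s : cP1 * e3 < ((x ^ (2:ℕ) + (1 - x) * d / w) * (1 - x) * ((x - r) * (1 - t - r) / (t * (2 - x ^ (2:ℕ) - (1 - x) * r) - x * (x - r)))) → cPres = 0 ∧ poolres = (pool1 - ((x ^ (2:ℕ) + (1 - x) * d / w) * (1 - x) * ((x - r) * (1 - t - r) / (t * (2 - x ^ (2:ℕ) - (1 - x) * r) - x * (x - r)))) + cP1 * e3))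
    (_hpre : cPres * e2P ≤ ((1 - (x ^ (2:ℕ) + (1 - x) * d / w)) * (1 - x) * ((1 + x - r) * (r - x + t * (2 - x)) / (t * (2 - x ^ (2:ℕ) - (1 - x) * r) - x * (x - r)))))
    (hs4 : (((1 - (x ^ (2:ℕ) + (1 - x) * d / w)) * x) * (((1 - w) - ((1 - x) * (r + d - 2 * w) + x ^ (2:ℕ) * (1 - w))) / ((1 - x) * (r + d - 2 * w) + x ^ (2:ℕ) * (1 - w)))) < (((x ^ (2:ℕ) + (1 - x) * d / w) * (1 - x) * ((1 + x - r) * (r - x + t * (2 - x)) / (t * (2 - x ^ (2:ℕ) - (1 - x) * r) - x * (x - r)))))) :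
    ((1 - (x ^ (2:ℕ) + (1 - x) * d / w)) * (1 - x) * ((x - r) * (1 - t - r) / (t * (2 - x ^ (2:ℕ) - (1 - x) * r) - x * (x - r)))) + ((1 - (x ^ (2:ℕ) + (1 - x) * d / w)) * (1 - x) * ((1 + x - r) * (r - x + t * (2 - x)) / (t * (2 - x ^ (2:ℕ) - (1 - x) * r) - x * (x - r)))) ≤ cPres * e2P + poolres := by
  have hD : 0 < t * (2 - x ^ (2:ℕ) - (1 - x) * r) - x * (x - r) := LSCoreMMG.D_pos x r t hx0 hx1 hr0 hrx hre
  have hxw : x * w ≤ x := by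
    have h_ := mul_pos hx0 (sub_pos.2 hw1)
    linarith
  have hb4 : r + d - 2 * w < x * (1 - w) := by
    have h_ := mul_pos hw0 (sub_pos.2 hx1)
    linarith
  have hb4c : r + d - 2 * w < 1 - w := by
    have h_ := mul_pos (sub_pos.2 hw1) (sub_pos.2 hx1)
    linarith
  have hb3c : r + d + 2 * t - 2 * w < 1 + t - w := by
    have h_ := mul_pos hw0 (sub_pos.2 hx1)
    linarith
  have hg0 : 0 ≤ (x ^ (2:ℕ) + (1 - x) * d / w) := by positivity
  have hlam : 0 ≤ ((x - r) * (1 - t - r) / (t * (2 - x ^ (2:ℕ) - (1 - x) * r) - x * (x - r))) := div_nonneg (mul_nonneg (by linarith) (by linarith)) hD.le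
  have hlaml : 0 ≤ ((1 + x - r) * (r - x + t * (2 - x)) / (t * (2 - x ^ (2:ℕ) - (1 - x) * r) - x * (x - r))) := div_nonneg (mul_nonneg (by linarith) hre.le) hD.le
  have hcM1 : 0 ≤ ((x ^ (2:ℕ) + (1 - x) * d / w) * (1 - x) * ((x - r) * (1 - t - r) / (t * (2 - x ^ (2:ℕ) - (1 - x) * r) - x * (x - r)))) := mul_nonneg (mul_nonneg hg0 (by linarith)) hlam
  have hcM2 : 0 ≤ ((x ^ (2:ℕ) + (1 - x) * d / w) * (1 - x) * ((1 + x - r) * (r - x + t * (2 - x)) / (t * (2 - x ^ (2:ℕ) - (1 - x) * r) - x * (x - r)))) := mul_nonneg (mul_nonneg hg0 (by linarith)) hlaml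
  have hcM1pos : 0 < ((x ^ (2:ℕ) + (1 - x) * d / w) * (1 - x) * ((x - r) * (1 - t - r) / (t * (2 - x ^ (2:ℕ) - (1 - x) * r) - x * (x - r)))) := by
    apply mul_pos (mul_pos (by positivity) (by linarith))
    exact div_pos (mul_pos (by linarith) (by linarith)) hD
  have hG4 : 0 < ((1 - x) * (r + d - 2 * w) + x ^ (2:ℕ) * (1 - w)) := by
    have h_1 := mul_pos (sub_pos.2 hx1) (show (0:ℝ) < r + d - 2 * w by linarith)
    have h_2 := mul_pos (mul_pos hx0 hx0) (sub_pos.2 hw1)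
    linarith
  have he4num : 0 < (1 - w) - ((1 - x) * (r + d - 2 * w) + x ^ (2:ℕ) * (1 - w)) := by
    have h_1 := mul_pos (sub_pos.2 hx1) (show (0:ℝ) < (1 - w) * (1 + x) - (r + d - 2 * w) by have h_0 := mul_pos hx0 (sub_pos.2 hw1); linarith)
    linarith
  have he4pos : 0 < (((1 - w) - ((1 - x) * (r + d - 2 * w) + x ^ (2:ℕ) * (1 - w))) / ((1 - x) * (r + d - 2 * w) + x ^ (2:ℕ) * (1 - w))) := div_pos he4num hG4
  have h4w : ((1 - x) / x) ≤ (((1 - w) - ((1 - x) * (r + d - 2 * w) + x ^ (2:ℕ) * (1 - w))) / ((1 - x) * (r + d - 2 * w) + x ^ (2:ℕ) * (1 - w))) := by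
    have h1 : ((1 - x) * (r + d - 2 * w) + x ^ (2:ℕ) * (1 - w)) ≤ x * (1 - w) := by
      have h_1 := mul_nonneg (sub_pos.2 hx1).le (sub_nonneg.2 hb4.le)
      linarith
    rw [div_le_div_iff₀ hx0 hG4]; linarith [h1]
  have hsum : ((x - r) * (1 - t - r) / (t * (2 - x ^ (2:ℕ) - (1 - x) * r) - x * (x - r))) + ((1 + x - r) * (r - x + t * (2 - x)) / (t * (2 - x ^ (2:ℕ) - (1 - x) * r) - x * (x - r))) = 1 := by rw [← add_div, div_eq_one_iff_eq hD.ne']; ring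
  have hP : ((1 - (x ^ (2:ℕ) + (1 - x) * d / w)) * (1 - x) * ((x - r) * (1 - t - r) / (t * (2 - x ^ (2:ℕ) - (1 - x) * r) - x * (x - r)))) + ((1 - (x ^ (2:ℕ) + (1 - x) * d / w)) * (1 - x) * ((1 + x - r) * (r - x + t * (2 - x)) / (t * (2 - x ^ (2:ℕ) - (1 - x) * r) - x * (x - r)))) = (1 - (x ^ (2:ℕ) + (1 - x) * d / w)) * (1 - x) := by linear_combination (1 - (x ^ (2:ℕ) + (1 - x) * d / w)) * (1 - x) * hsum
  have hg1p : 0 ≤ 1 - (x ^ (2:ℕ) + (1 - x) * d / w) := by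
    have h4 : d / w ≤ x := by rw [div_le_iff₀ hw0]; linarith
    have h5 : (1 - x) * d / w ≤ (1 - x) * x := by rw [mul_div_assoc]; exact mul_le_mul_of_nonneg_left h4 (by linarith)
    linarith [h5]
  have hgl : ((x ^ (2:ℕ) + (1 - x) * d / w) * (1 - x) * ((x - r) * (1 - t - r) / (t * (2 - x ^ (2:ℕ) - (1 - x) * r) - x * (x - r)))) ≤ (x ^ (2:ℕ) + (1 - x) * d / w) * (1 - x) := mul_le_of_le_one_right (mul_nonneg hg0 (by linarith)) (by linarith [hsum, hlaml])
  have hgsum : (x ^ (2:ℕ) + (1 - x) * d / w) * (1 - x) * ((x - r) * (1 - t - r) / (t * (2 - x ^ (2:ℕ) - (1 - x) * r) - x * (x - r))) + (x ^ (2:ℕ) + (1 - x) * d / w) * (1 - x) * ((1 + x - r) * (r - x + t * (2 - x)) / (t * (2 - x ^ (2:ℕ) - (1 - x) * r) - x * (x - r))) = (x ^ (2:ℕ) + (1 - x) * d / w) * (1 - x) := by rw [← mul_add, hsum, mul_one]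
  have hcP0 : 0 ≤ ((1 - (x ^ (2:ℕ) + (1 - x) * d / w)) * x) := mul_nonneg hg1p hx0.le
  obtain ⟨hcP1, hpl1⟩ := hc4_s hs4
  rw [hcP1, hpl1] at _hc3_f hc3_s
  have hs3 : 0 * e3 < ((x ^ (2:ℕ) + (1 - x) * d / w) * (1 - x) * ((x - r) * (1 - t - r) / (t * (2 - x ^ (2:ℕ) - (1 - x) * r) - x * (x - r)))) := by rw [zero_mul]; exact hcM1pos
  obtain ⟨hcP, hpl⟩ := hc3_s hs3
  rw [hcP] at _hpre ⊢
  rw [hpl]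
  clear _hc4_f hc4_s _hc3_f hc3_s
  rcases le_or_gt (x * (1 + t - w)) ((r + d + 2 * t - 2 * w)) with hk3 | hk3
  · rw [h3_H hk3] at *
    have f1 : ((1 - (x ^ (2:ℕ) + (1 - x) * d / w)) * x) * ((1 - x) / x) ≤ ((1 - (x ^ (2:ℕ) + (1 - x) * d / w)) * x) * (((1 - w) - ((1 - x) * (r + d - 2 * w) + x ^ (2:ℕ) * (1 - w))) / ((1 - x) * (r + d - 2 * w) + x ^ (2:ℕ) * (1 - w))) := mul_le_mul_of_nonneg_left h4w hcP0
    have e1 : ((1 - (x ^ (2:ℕ) + (1 - x) * d / w)) * x) * ((1 - x) / x) = (1 - (x ^ (2:ℕ) + (1 - x) * d / w)) * (1 - x) := by field_simp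
    linarith [f1, e1, hgsum, hP]

  · rw [h3_L hk3] at *
    have f1 : ((1 - (x ^ (2:ℕ) + (1 - x) * d / w)) * x) * ((1 - x) / x) ≤ ((1 - (x ^ (2:ℕ) + (1 - x) * d / w)) * x) * (((1 - w) - ((1 - x) * (r + d - 2 * w) + x ^ (2:ℕ) * (1 - w))) / ((1 - x) * (r + d - 2 * w) + x ^ (2:ℕ) * (1 - w))) := mul_le_mul_of_nonneg_left h4w hcP0
    have e1 : ((1 - (x ^ (2:ℕ) + (1 - x) * d / w)) * x) * ((1 - x) / x) = (1 - (x ^ (2:ℕ) + (1 - x) * d / w)) * (1 - x) := by field_simp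
    linarith [f1, e1, hgsum, hP]



end LSCoreLLG

end LawDec

end Quant

end Summit.CriticalPhenomena.PercolationContinuityZ3.Theorems
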